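import Literature.Analysis.FluidPDE.PeriodicCellTransfer
import HarnessLib

/-!
# Transfer of Sobolev energies: flat torus → period cell (restriction)

Analysis/FluidPDE support file for the energy-method construction of Euler flows in the periodic
cylinder (`Literature.Analysis.FluidPDE.KatoLai1984_periodicCylinderUniformExistence`), step
"restrict the torus solution back to the cell" of Kato–Lai's §7 ("if `u'` is a solution … then its
restriction `u` solves (7.1)"). For a smooth real torus field `V : T³ → ℝ³` the box field
`fromTorus L V` (file `PeriodicBoxTorus`) satisfies

  `‖fromTorus L V‖_{W^{m,2}(cell L)} ≤ C(L, m) (∑_k (1 + |k|²)^m ‖V̂(k)‖²)^{1/2}`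

(`exists_eSobolevDomainNorm_fromTorus_le`): the word terms of the tree's Sobolev norm on the cell
are bounded pointwise by the coordinate word derivatives (`PeriodicCellTransfer`), the cell sits
in the period box where the `L²` norms are read off the torus exactly
(`lintegral_iterDirDeriv_fromTorus_sq`), and on the torus Plancherel bounds word derivatives by
the lattice energy (`Torus.integral_norm_sq_wordDeriv_le`).

Everything is proved; no named fact and no `sorry` is introduced.

## Mathlib / tree search

Tree: `eSobolevDomainNorm_eq_sum_iterDeriv`, `PeriodicCylinder.iterDeriv_apply_eq_iteratedFDeriv`,
`norm_apply_basis_le`, `norm_iteratedFDeriv_le_sum_words`, `lintegral_iterDirDeriv_fromTorus_sq`,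
`Torus.integral_norm_sq_wordDeriv_le`. Mathlib: `eLpNorm_le_mul_eLpNorm_of_ae_le_mul`,
`eLpNorm_sum_le`, `eLpNorm_mono_measure`, `ENNReal.pow_le_pow_left_iff`.

## References

* T. Kato, C. Y. Lai, J. Funct. Anal. 56 (1984) 15–28, §7. [KatoLai1984]
-/

noncomputable section

open MeasureTheory Set Function Filter Topology TopologicalSpace WithLp Finset
open scoped ContDiff NNReal ENNReal

namespace Literature.Analysis.FluidPDE

open FunctionSpaces FunctionSpaces.Torus Calculus.WhitneyConvex UnitAddTorus

/-- Local notation for physical space `ℝ³ = EuclideanSpace ℝ (Fin 3)`. -/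
local notation "ℝ³" => EuclideanSpace ℝ (Fin 3)

namespace PeriodicCylinder

/-- The period cell sits in the open period box. [folklore] -/
theorem cylinderCell_subset_openBox (L : ℝ) : (cylinderCell L : Set ℝ³) ⊆ openBox L := by
  intro x hx
  have hx' : cylRadius x < 1 ∧ x 2 ∈ Ioo 0 L := hx
  have h0 : |x 0| < 2 := (abs_apply_le_cylRadius x (Or.inl rfl)).trans_lt (by linarith [hx'.1])
  have h1 : |x 1| < 2 := (abs_apply_le_cylRadius x (Or.inr rfl)).trans_lt (by linarith [hx'.1])
  exact ⟨abs_lt.1 h0, abs_lt.1 h1, hx'.2⟩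

/-- `a² ≤ ofReal t` gives `a ≤ ofReal √t`. [folklore] -/
theorem le_ofReal_sqrt_of_sq_le {a : ℝ≥0∞} {t : ℝ} (ht : 0 ≤ t) (h : a ^ 2 ≤ ENNReal.ofReal t) :
    a ≤ ENNReal.ofReal (Real.sqrt t) := by
  rw [← ENNReal.pow_le_pow_left_iff two_ne_zero, ← ENNReal.ofReal_pow (Real.sqrt_nonneg _), Real.sq_sqrt ht]
  exact h

variable {F : Type*} [NormedAddCommGroup F] [NormedSpace ℝ F]

/-- **The word energy** `W_m(V) = ∑_{l ≤ m} ∑_{r : Fin l → Fin 3} ∫ ‖∂_r V‖²` of a smooth torus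
function (all coordinate words of length `≤ m`). [folklore] -/
def wordEnergy (m : ℕ) (V : UnitAddTorus (Fin 3) → F) : ℝ :=
  ∑ l ∈ range (m + 1), ∑ r : Fin l → Fin 3, ∫ ξ, ‖Torus.wordDeriv (List.ofFn r) V ξ‖ ^ 2

/-- The word energy is nonnegative. [folklore] -/
theorem wordEnergy_nonneg (m : ℕ) (V : UnitAddTorus (Fin 3) → F) : 0 ≤ wordEnergy m V :=
  sum_nonneg fun _ _ => sum_nonneg fun _ _ => integral_nonneg fun _ => sq_nonneg _

/-- One word is below the word energy. [folklore] -/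
theorem integral_le_wordEnergy {m l : ℕ} (hl : l ≤ m) (V : UnitAddTorus (Fin 3) → F) (r : Fin l → Fin 3) :
    ∫ ξ, ‖Torus.wordDeriv (List.ofFn r) V ξ‖ ^ 2 ≤ wordEnergy m V := by
  have h1 : ∫ ξ, ‖Torus.wordDeriv (List.ofFn r) V ξ‖ ^ 2 ≤
      ∑ r' : Fin l → Fin 3, ∫ ξ, ‖Torus.wordDeriv (List.ofFn r') V ξ‖ ^ 2 :=
    single_le_sum (f := fun r' : Fin l → Fin 3 => ∫ ξ, ‖Torus.wordDeriv (List.ofFn r') V ξ‖ ^ 2)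
      (fun _ _ => integral_nonneg fun _ => sq_nonneg _) (mem_univ r)
  refine h1.trans ?_
  exact single_le_sum (f := fun l' => ∑ r' : Fin l' → Fin 3, ∫ ξ, ‖Torus.wordDeriv (List.ofFn r') V ξ‖ ^ 2)
    (fun _ _ => sum_nonneg fun _ _ => integral_nonneg fun _ => sq_nonneg _) (mem_range.2 (Nat.lt_succ_of_le hl))

/-- **The `L²(B_L)` norm of a coordinate word derivative of `fromTorus L V`**: for `|r| = l`,
`‖∂_r (fromTorus L V)‖²_{L²(B_L)} ≤ 16 L (min 4 L)^{-2l} ∫_{T³} ‖∂_r V‖²`. [folklore] -/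
theorem lintegral_openBox_wordDeriv_fromTorus_le {L : ℝ} (hL : 0 < L) {l : ℕ}
    {V : UnitAddTorus (Fin 3) → F} (hV : IsSmooth V) (r : Fin l → Fin 3) :
    ∫⁻ x in openBox L, ‖iterDirDeriv (Torus.wordVecs (List.ofFn r)) (fromTorus L V) x‖ₑ ^ 2 ≤
      ENNReal.ofReal (16 * L / ((min 4 L) ^ l) ^ 2 * ∫ ξ, ‖Torus.wordDeriv (List.ofFn r) V ξ‖ ^ 2) := by
  set S : ℝ := ∫ ξ, ‖Torus.wordDeriv (List.ofFn r) V ξ‖ ^ 2 with hS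
  have hS0 : 0 ≤ S := integral_nonneg fun _ => sq_nonneg _
  have hmin : 0 < min 4 L := lt_min (by norm_num) hL
  have hμ : 0 < (min 4 L) ^ l := pow_pos hmin l
  have hs : (min 4 L) ^ l ≤ boxScale L (List.ofFn r) := by
    have := pow_le_boxScale hL (List.ofFn r)
    rwa [List.length_ofFn] at this
  have hs0 : 0 < boxScale L (List.ofFn r) := boxScale_pos hL _
  have key := lintegral_iterDirDeriv_fromTorus_sq hL hV (List.ofFn r)
  have hT : ∫⁻ ξ, ‖Torus.wordDeriv (List.ofFn r) V ξ‖ₑ ^ 2 = ENNReal.ofReal S :=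
    (ofReal_integral_norm_sq (Torus.isSmooth_wordDeriv hV _)).symm
  have hsq : ENNReal.ofReal (boxScale L (List.ofFn r) ^ 2) ≠ 0 := by
    rw [ENNReal.ofReal_ne_zero_iff]; positivity
  calc ∫⁻ x in openBox L, ‖iterDirDeriv (Torus.wordVecs (List.ofFn r)) (fromTorus L V) x‖ₑ ^ 2
      = (ENNReal.ofReal (boxScale L (List.ofFn r) ^ 2))⁻¹ * (ENNReal.ofReal (boxScale L (List.ofFn r) ^ 2) *
          ∫⁻ x in openBox L, ‖iterDirDeriv (Torus.wordVecs (List.ofFn r)) (fromTorus L V) x‖ₑ ^ 2) := by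
        rw [← mul_assoc, ENNReal.inv_mul_cancel hsq ENNReal.ofReal_ne_top, one_mul]
    _ = (ENNReal.ofReal (boxScale L (List.ofFn r) ^ 2))⁻¹ * (ENNReal.ofReal (16 * L) * ENNReal.ofReal S) := by
        rw [key, hT]
    _ ≤ (ENNReal.ofReal (((min 4 L) ^ l) ^ 2))⁻¹ * (ENNReal.ofReal (16 * L) * ENNReal.ofReal S) := by
        refine mul_le_mul' ?_ le_rfl
        rw [ENNReal.inv_le_inv]
        exact ENNReal.ofReal_le_ofReal (pow_le_pow_left₀ hμ.le hs 2)
    _ = ENNReal.ofReal (16 * L / ((min 4 L) ^ l) ^ 2 * S) := by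
        rw [← ENNReal.ofReal_inv_of_pos (by positivity), ← ENNReal.ofReal_mul (by positivity),
          ← ENNReal.ofReal_mul (by positivity), div_eq_mul_inv]
        ring_nf

/-- The constant `C₁ = B_e K_std` of the pointwise comparison (`e = Module.finBasis ℝ ℝ³`, `std`
the standard basis). [folklore] -/
def wordConst : ℝ :=
  vecBound (Module.finBasis ℝ ℝ³) * coordBound (EuclideanSpace.basisFun (Fin 3) ℝ).toBasis

/-- `C₁ ≥ 0`. [folklore] -/
theorem wordConst_nonneg : 0 ≤ wordConst :=
  mul_nonneg (zero_le_one.trans (one_le_vecBound _)) (coordBound_nonneg _)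

/-- **Pointwise**: the word terms of the Sobolev norm of a smooth `g` by its coordinate word
derivatives, `‖iterDeriv l (e ∘ w) g (x)‖ ≤ C₁^l ∑_r ‖∂_r g (x)‖`. [folklore] -/
theorem norm_iterDeriv_finBasis_le {g : ℝ³ → F} (hg : ContDiff ℝ ∞ g) (l : ℕ)
    (w : Fin l → Fin (Module.finrank ℝ ℝ³)) (x : ℝ³) :
    ‖iterDeriv l (fun j => Module.finBasis ℝ ℝ³ (w j)) g x‖ ≤
      wordConst ^ l * ∑ r : Fin l → Fin 3, ‖iterDirDeriv (Torus.wordVecs (List.ofFn r)) g x‖ := by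
  rw [iterDeriv_apply_eq_iteratedFDeriv isOpen_univ hg.contDiffOn l _ (mem_univ x)]
  have h1 := norm_apply_basis_le (Module.finBasis ℝ ℝ³) (iteratedFDeriv ℝ l g x) fun j => w (Fin.rev j)
  have h2 := norm_iteratedFDeriv_le_sum_words isOpen_univ hg.contDiffOn l (mem_univ x)
  have hB : 0 ≤ vecBound (Module.finBasis ℝ ℝ³) := zero_le_one.trans (one_le_vecBound _)
  calc ‖iteratedFDeriv ℝ l g x fun j => Module.finBasis ℝ ℝ³ (w (Fin.rev j))‖
      ≤ vecBound (Module.finBasis ℝ ℝ³) ^ l * ‖iteratedFDeriv ℝ l g x‖ := h1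
    _ ≤ vecBound (Module.finBasis ℝ ℝ³) ^ l * (coordBound (EuclideanSpace.basisFun (Fin 3) ℝ).toBasis ^ l *
          ∑ r : Fin l → Fin 3, ‖iterDirDeriv (Torus.wordVecs (List.ofFn r)) g x‖) :=
        mul_le_mul_of_nonneg_left h2 (pow_nonneg hB _)
    _ = _ := by rw [wordConst, mul_pow]; ring

/-- The per-order constant `t_l = 16 L (min 4 L)^{-2l}` of the `L²(B_L)` bound. [folklore] -/
def boxConst (L : ℝ) (l : ℕ) : ℝ := 16 * L / ((min 4 L) ^ l) ^ 2

/-- `t_l ≥ 0` for `L > 0`. [folklore] -/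
theorem boxConst_nonneg {L : ℝ} (hL : 0 < L) (l : ℕ) : 0 ≤ boxConst L l := by
  unfold boxConst; positivity

/-- **One word term of the Sobolev norm of `fromTorus L V` on the cell by the word energy.**
[folklore] -/
theorem eLpNorm_cell_iterDeriv_fromTorus_le {L : ℝ} (hL : 0 < L) {m l : ℕ} (hl : l ≤ m)
    {V : UnitAddTorus (Fin 3) → F} (hV : IsSmooth V) (w : Fin l → Fin (Module.finrank ℝ ℝ³)) :
    eLpNorm (iterDeriv l (fun j => Module.finBasis ℝ ℝ³ (w j)) (fromTorus L V)) 2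
        (volume.restrict (cylinderCell L : Set ℝ³)) ≤
      ENNReal.ofReal (wordConst ^ l * ((Fintype.card (Fin l → Fin 3) : ℝ) *
        Real.sqrt (boxConst L l * wordEnergy m V))) := by
  set S : ℝ := wordEnergy m V with hS
  have hS0 : 0 ≤ S := wordEnergy_nonneg m V
  set g : ℝ³ → F := fromTorus L V with hgdef
  have hg : ContDiff ℝ ∞ g := contDiff_fromTorus L hV
  set D : (Fin l → Fin 3) → ℝ³ → F := fun r => iterDirDeriv (Torus.wordVecs (List.ofFn r)) g with hD
  have hDc : ∀ r, Continuous (D r) := fun r => (contDiff_iterDirDeriv hg _).continuous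
  -- step 1: pointwise comparison
  have h1 : eLpNorm (iterDeriv l (fun j => Module.finBasis ℝ ℝ³ (w j)) g) 2 (volume.restrict (cylinderCell L : Set ℝ³)) ≤
      ENNReal.ofReal (wordConst ^ l) * eLpNorm (fun x => ∑ r : Fin l → Fin 3, ‖D r x‖) 2
        (volume.restrict (cylinderCell L : Set ℝ³)) := by
    refine eLpNorm_le_mul_eLpNorm_of_ae_le_mul (ae_of_all _ fun x => ?_) 2
    rw [Real.norm_of_nonneg (sum_nonneg fun r _ => norm_nonneg _)]
    exact norm_iterDeriv_finBasis_le hg l w x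
  -- step 2: triangle inequality over the coordinate words
  have h2 : eLpNorm (fun x => ∑ r : Fin l → Fin 3, ‖D r x‖) 2 (volume.restrict (cylinderCell L : Set ℝ³)) ≤
      ∑ r : Fin l → Fin 3, eLpNorm (D r) 2 (volume.restrict (cylinderCell L : Set ℝ³)) := by
    have hfun : (fun x => ∑ r : Fin l → Fin 3, ‖D r x‖) = ∑ r : Fin l → Fin 3, fun x => ‖D r x‖ := by
      funext x; simp only [Finset.sum_apply]
    rw [hfun]
    refine (eLpNorm_sum_le (fun r _ => (hDc r).norm.aestronglyMeasurable) one_le_two).trans (le_of_eq ?_)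
    exact sum_congr rfl fun r _ => eLpNorm_norm (D r)
  -- step 3: each coordinate word by the word energy
  have h3 : ∀ r : Fin l → Fin 3, eLpNorm (D r) 2 (volume.restrict (cylinderCell L : Set ℝ³)) ≤
      ENNReal.ofReal (Real.sqrt (boxConst L l * S)) := by
    intro r
    refine (eLpNorm_mono_measure (D r) (Measure.restrict_mono (cylinderCell_subset_openBox L) le_rfl)).trans ?_
    refine le_ofReal_sqrt_of_sq_le (mul_nonneg (boxConst_nonneg hL l) hS0) ?_
    rw [eLpNorm_two_sq_eq]
    refine (lintegral_openBox_wordDeriv_fromTorus_le hL hV r).trans (ENNReal.ofReal_le_ofReal ?_)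
    exact mul_le_mul_of_nonneg_left (integral_le_wordEnergy hl V r) (boxConst_nonneg hL l)
  calc eLpNorm (iterDeriv l (fun j => Module.finBasis ℝ ℝ³ (w j)) g) 2 (volume.restrict (cylinderCell L : Set ℝ³))
      ≤ ENNReal.ofReal (wordConst ^ l) * ∑ r : Fin l → Fin 3, eLpNorm (D r) 2 (volume.restrict (cylinderCell L : Set ℝ³)) :=
        h1.trans (mul_le_mul_of_nonneg_left h2 bot_le)
    _ ≤ ENNReal.ofReal (wordConst ^ l) * ∑ _r : Fin l → Fin 3, ENNReal.ofReal (Real.sqrt (boxConst L l * S)) :=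
        mul_le_mul_of_nonneg_left (sum_le_sum fun r _ => h3 r) bot_le
    _ = _ := by
        rw [sum_const, card_univ, nsmul_eq_mul, ← ENNReal.ofReal_natCast,
          ← ENNReal.ofReal_mul (Nat.cast_nonneg _), ← ENNReal.ofReal_mul (pow_nonneg wordConst_nonneg _)]

variable [CompleteSpace F]

/-- **The Sobolev norm of the restriction by the word energy**: for `L > 0` and `m` there is
`C` with `‖fromTorus L V‖_{W^{m,2}(cell L)} ≤ C √(W_m(V))` for every smooth torus function `V`
(any complete target space). [cite: KatoLai1984, §7] -/
theorem exists_eSobolevDomainNorm_fromTorus_le_wordEnergy {L : ℝ} (hL : 0 < L) (m : ℕ) : ∃ C : ℝ, 0 ≤ C ∧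
    ∀ (V : UnitAddTorus (Fin 3) → F), IsSmooth V →
      eSobolevDomainNorm m 2 (cylinderCell L) volume (fromTorus L V) ≤
        ENNReal.ofReal (C * Real.sqrt (wordEnergy m V)) := by
  -- per-order constants
  set κ : ℕ → ℝ := fun l => (Fintype.card (Fin l → Fin (Module.finrank ℝ ℝ³)) : ℝ) *
    (wordConst ^ l * ((Fintype.card (Fin l → Fin 3) : ℝ) * Real.sqrt (boxConst L l))) with hκ
  have hκ0 : ∀ l, 0 ≤ κ l := fun l => by
    have := wordConst_nonneg
    have := boxConst_nonneg hL l
    positivity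
  refine ⟨∑ l ∈ range (m + 1), κ l, sum_nonneg fun l _ => hκ0 l, fun V hV => ?_⟩
  set S : ℝ := wordEnergy m V with hS
  have hS0 : 0 ≤ S := wordEnergy_nonneg m V
  have hg : ContDiffOn ℝ ∞ (fromTorus L V) (cylinderCell L : Set ℝ³) := (contDiff_fromTorus L hV).contDiffOn
  rw [eSobolevDomainNorm_eq_sum_iterDeriv 2 m hg]
  have hterm : ∀ l ∈ range (m + 1), ∀ w : Fin l → Fin (Module.finrank ℝ ℝ³),
      eLpNorm (iterDeriv l (fun j => Module.finBasis ℝ ℝ³ (w j)) (fromTorus L V)) 2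
          (volume.restrict (cylinderCell L : Set ℝ³)) ≤
        ENNReal.ofReal (wordConst ^ l * ((Fintype.card (Fin l → Fin 3) : ℝ) * Real.sqrt (boxConst L l)) *
          Real.sqrt S) := by
    intro l hl w
    have hlm : l ≤ m := Nat.lt_succ_iff.1 (mem_range.1 hl)
    refine (eLpNorm_cell_iterDeriv_fromTorus_le hL hlm hV w).trans (le_of_eq ?_)
    rw [← hS, Real.sqrt_mul (boxConst_nonneg hL l)]
    congr 1
    ring
  calc ∑ l ∈ range (m + 1), ∑ w : Fin l → Fin (Module.finrank ℝ ℝ³),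
        eLpNorm (iterDeriv l (fun j => Module.finBasis ℝ ℝ³ (w j)) (fromTorus L V)) 2
          (volume.restrict (cylinderCell L : Set ℝ³))
      ≤ ∑ l ∈ range (m + 1), ∑ _w : Fin l → Fin (Module.finrank ℝ ℝ³),
          ENNReal.ofReal (wordConst ^ l * ((Fintype.card (Fin l → Fin 3) : ℝ) * Real.sqrt (boxConst L l)) *
            Real.sqrt S) := sum_le_sum fun l hl => sum_le_sum fun w _ => hterm l hl w
    _ = ∑ l ∈ range (m + 1), ENNReal.ofReal (κ l * Real.sqrt S) := by
        refine sum_congr rfl fun l _ => ?_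
        rw [sum_const, card_univ, nsmul_eq_mul, ← ENNReal.ofReal_natCast, ← ENNReal.ofReal_mul (Nat.cast_nonneg _), hκ]
        congr 1
        ring
    _ = ENNReal.ofReal ((∑ l ∈ range (m + 1), κ l) * Real.sqrt S) := by
        rw [sum_mul, ENNReal.ofReal_sum_of_nonneg fun l _ => mul_nonneg (hκ0 l) (Real.sqrt_nonneg _)]

/-- **The word energy of a real field by the lattice energy**:
`W_m(V) ≤ (∑_{l ≤ m} 3^l) (4π²)^m ∑_k (1 + |k|²)^m ‖V̂(k)‖²`. [folklore] -/
theorem wordEnergy_le_latticeEnergy {m : ℕ} {V : UnitAddTorus (Fin 3) → ℝ³} (hV : IsSmooth V) :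
    wordEnergy m V ≤ (∑ l ∈ range (m + 1), (Fintype.card (Fin l → Fin 3) : ℝ)) * ((4 * Real.pi ^ 2) ^ m *
      ∑' k : Fin 3 → ℤ, (1 + freqNormSq k) ^ m * ‖mFourierCoeff (EuclideanSpace.complexify ∘ V) k‖ ^ 2) := by
  unfold wordEnergy
  rw [sum_mul]
  refine sum_le_sum fun l hl => ?_
  have hlm : l ≤ m := Nat.lt_succ_iff.1 (mem_range.1 hl)
  calc ∑ r : Fin l → Fin 3, ∫ ξ, ‖Torus.wordDeriv (List.ofFn r) V ξ‖ ^ 2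
      ≤ ∑ _r : Fin l → Fin 3, (4 * Real.pi ^ 2) ^ m *
          ∑' k : Fin 3 → ℤ, (1 + freqNormSq k) ^ m * ‖mFourierCoeff (EuclideanSpace.complexify ∘ V) k‖ ^ 2 :=
        sum_le_sum fun r _ => Torus.integral_norm_sq_wordDeriv_le hV (by rw [List.length_ofFn]; exact hlm)
    _ = _ := by rw [sum_const, card_univ, nsmul_eq_mul]

/-- **The Sobolev norm of the restriction by the lattice energy**: for `L > 0` and `m`, there is
`C` with `‖fromTorus L V‖_{W^{m,2}(cell L)} ≤ C (∑_k (1 + |k|²)^m ‖V̂(k)‖²)^{1/2}` for every smooth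
real torus field `V`. [cite: KatoLai1984, §7] -/
theorem exists_eSobolevDomainNorm_fromTorus_le {L : ℝ} (hL : 0 < L) (m : ℕ) : ∃ C : ℝ, 0 ≤ C ∧
    ∀ (V : UnitAddTorus (Fin 3) → ℝ³), IsSmooth V →
      eSobolevDomainNorm m 2 (cylinderCell L) volume (fromTorus L V) ≤
        ENNReal.ofReal (C * Real.sqrt (∑' k : Fin 3 → ℤ, (1 + freqNormSq k) ^ m *
          ‖mFourierCoeff (EuclideanSpace.complexify ∘ V) k‖ ^ 2)) := by
  obtain ⟨C, hC0, hC⟩ := exists_eSobolevDomainNorm_fromTorus_le_wordEnergy (F := ℝ³) hL m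
  set A : ℝ := (∑ l ∈ range (m + 1), (Fintype.card (Fin l → Fin 3) : ℝ)) * (4 * Real.pi ^ 2) ^ m with hA
  have hA0 : 0 ≤ A := by positivity
  refine ⟨C * Real.sqrt A, by positivity, fun V hV => ?_⟩
  set S : ℝ := ∑' k : Fin 3 → ℤ, (1 + freqNormSq k) ^ m * ‖mFourierCoeff (EuclideanSpace.complexify ∘ V) k‖ ^ 2
    with hS
  have hS0 : 0 ≤ S := tsum_nonneg fun k => mul_nonneg (pow_nonneg (by linarith [freqNormSq_nonneg k]) _) (sq_nonneg _)
  have hW : wordEnergy m V ≤ A * S := by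
    have := wordEnergy_le_latticeEnergy (m := m) hV
    rw [← hS] at this
    calc wordEnergy m V ≤ _ := this
      _ = A * S := by rw [hA]; ring
  refine (hC V hV).trans (ENNReal.ofReal_le_ofReal ?_)
  calc C * Real.sqrt (wordEnergy m V) ≤ C * Real.sqrt (A * S) := mul_le_mul_of_nonneg_left (Real.sqrt_le_sqrt hW) hC0
    _ = C * Real.sqrt A * Real.sqrt S := by rw [Real.sqrt_mul hA0]; ring

end PeriodicCylinder

end Literature.Analysis.FluidPDE
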